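import Summits.HodgeConjecture.HodgeConjecture.Theses.LinearSystemTorelli
import Literature.AlgebraicGeometry.HodgeTheory.ComplexGysinRational
import Literature.AlgebraicGeometry.HodgeTheory.GysinHodgeClassLiftProofs
import Literature.AlgebraicGeometry.HodgeTheory.SupportedClassesRationalProofs
import Literature.AlgebraicGeometry.HodgeTheory.RationalClassesRingChange

/-!
# Crux `TranscendentalOrSupported` (stmt-HodgeConjecture-10853), line `Sketch` — stub
# `stub_gysinRangeRational`: the image of a Gysin morphism is spanned by its rational classes

Helper file for the line skeleton (v6, isotypic bootstrap in Gysin form) of the crux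
`TranscendentalOrSupported` of route `LinearSystemTorelli` (GHC(2p, coniveau 1) in Grothendieck's
sub-Hodge form), registered stub `stub_gysinRangeRational`. Notation: `g : Y ⟶ X` a morphism of
smooth projective complex varieties of dimensions `m`, `n`, `μ` an orientation family,
`g_* = complexGysin μ hY hX g hab : Hᵃ(Y(ℂ); ℂ) → Hᵇ(X(ℂ); ℂ)` (`a + 2n = b + 2m`) its Gysin morphism
(`ComplexGysin`: `PD_X⁻¹ ∘ g(ℂ)_* ∘ PD_Y` in degrees `a ≤ 2m`, `0` beyond), and
`ι = singularCohomology.ringChange (ℚ ↪ ℂ) : Hᵏ(–; ℚ) → Hᵏ(–; ℂ)` the change of coefficients, whose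
image is exactly the set of rational classes (`isRationalClass_iff_exists_ringChange`).

CLAIM (`stub_gysinRangeRational`). `im g_*` is spanned over `ℂ` by its rational classes:
`span ℂ {x ∈ im g_* | x rational} = im g_*`.

PROOF (Voisin I §7.3.2: the Gysin morphism is induced by `g(ℂ)_*` on RATIONAL homology through
Poincaré duality; Fulton, Young Tableaux, App. B §B.1 (5)).
* `≤` is `Submodule.span_le`.
* `≥`: `Hᵃ(Y(ℂ); ℂ)` is spanned by its rational classes
  (`span_isRationalClass_eq_top_of_isSmoothProjective_holds`, Voisin I §7.1.1), so it suffices to put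
  `g_* c` in the span for `c = ι y` rational (`gysinRangeRational_apply_mem_span`). In degrees
  `a > 2m`, `g_* = 0` (`complexGysin_of_lt`). In degrees `a + q = 2m`, choose `ℚ`-orientations
  `ν_Y`, `ν_X` of `Y(ℂ)`, `X(ℂ)` (`Motives.ComplexPoints.isOrientableOver`), `ν_X` with Poincaré
  duality (`exists_ratOrientation_hasPoincareDuality`); then for ONE scalar `u ≠ 0`,
  `g_* (ι y) = u • ι (g_! y)` for all `y`, `g_! = gysinMap ν_Y ν_X g(ℂ)` the rational Gysin
  homomorphism (`complexGysin_ringChange_eq_smul_gysinMap`, with Poincaré duality for `μ`,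
  `OrientationFamily.hasPoincareDuality`). The class `ι (g_! y)` is rational
  (`isRationalClass_ringChange`) and lies in `im g_*` (it is `g_* (u⁻¹ • ι y)`), so
  `g_* (ι y) = u • ι (g_! y)` lies in the span.

Pure tree theorems; no named fact is taken as a hypothesis and none is introduced.

References: C. Voisin, *Hodge Theory and Complex Algebraic Geometry I* (CUP 2002), §7.1.1, §7.3.2;
W. Fulton, *Young Tableaux* (CUP 1997), App. B §B.1 (5); A. Grothendieck, *Hodge's general
conjecture is false for trivial reasons*, Topology 8 (1969), p. 300; A. Hatcher, *Algebraic
Topology* (CUP 2002), §3.1 p. 198, §3.3 Thm. 3.30.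
-/

-- `Summit.HodgeConjecture.HodgeConjecture.Theorems` is the mandated namespace (single-conjunct summit:
-- Sub = Summit), which `linter.dupNamespace` flags on every declaration; the lakefile turns the
-- linter off tree-wide (weak option), restated here so stand-alone elaboration is warning-free too.
set_option linter.dupNamespace false

noncomputable section

namespace Summit.HodgeConjecture.HodgeConjecture.Theorems

open CategoryTheory
open Literature.AlgebraicGeometry.Motives Literature.AlgebraicGeometry.HodgeTheory
open Literature.AlgebraicTopology.SingularHomology

variable {m n : ℕ} {Y X : SchemeOver ℂ}

/-! ### The Gysin image of a rational class -/

/-- **The Gysin image of a rational class lies in the span of the rational classes of the Gysin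
image.** For `g : Y ⟶ X` (smooth projective, dimensions `m`, `n`), an orientation family `μ`,
degrees `a + 2n = b + 2m` and a RATIONAL class `c ∈ Hᵃ(Y(ℂ); ℂ)`:
`g_* c ∈ span ℂ {x ∈ im g_* | x rational}`. In degrees `a > 2m`, `g_* = 0` (`complexGysin_of_lt`);
otherwise write `c = ι y` (`IsRationalClass.exists_ringChange_eq`) and use
`g_* (ι y) = u • ι (g_! y)`, `u ≠ 0`, with `g_! = gysinMap ν_Y ν_X g(ℂ)` the rational Gysin
homomorphism for `ℚ`-orientations `ν_Y`, `ν_X` (`ν_X` with Poincaré duality)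
(`complexGysin_ringChange_eq_smul_gysinMap`): `ι (g_! y) = g_* (u⁻¹ • ι y)` is a rational class of
`im g_*`. [cite: VoisinHodgeI2002, §7.3.2] [cite: FultonYoungTableaux1997, Appendix B §B.1 (5)] -/
theorem gysinRangeRational_apply_mem_span (μ : OrientationFamily) (hY : IsSmoothProjective m Y)
    (hX : IsSmoothProjective n X) (g : Y ⟶ X) {a b : ℕ} (hab : a + 2 * n = b + 2 * m)
    {c : complexBetti Y a} (hc : IsRationalClass c) :
    complexGysin μ hY hX g hab c ∈ Submodule.span ℂ {x : complexBetti X b |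
      x ∈ LinearMap.range (complexGysin μ hY hX g hab) ∧ IsRationalClass x} := by
  by_cases h : 2 * m < a
  · -- beyond the top degree of `Y(ℂ)` the Gysin morphism is `0`
    rw [complexGysin_of_lt hY hX g hab h, LinearMap.zero_apply]
    exact Submodule.zero_mem _
  · -- `ℚ`-orientations, `ν_X` with Poincaré duality
    obtain ⟨νY⟩ := Literature.AlgebraicGeometry.Motives.ComplexPoints.isOrientableOver ℚ hY
    obtain ⟨νX, hνX⟩ := exists_ratOrientation_hasPoincareDuality hX
    -- `g_* (ι y) = u • ι (g_! y)` with one scalar `u ≠ 0`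
    obtain ⟨u, hu0, hu⟩ := complexGysin_ringChange_eq_smul_gysinMap (μ := μ) μ.hasPoincareDuality
      hY hX g (a := a) (b := b) (q := 2 * m - a) (by omega) (by omega) νY νX hνX
    obtain ⟨y, rfl⟩ := hc.exists_ringChange_eq
    rw [hu y]
    refine Submodule.smul_mem _ _ (Submodule.subset_span ⟨?_, isRationalClass_ringChange _⟩)
    -- `ι (g_! y) = g_* (u⁻¹ • ι y)` lies in the image
    refine ⟨u⁻¹ • singularCohomology.ringChange (algebraMap ℚ ℂ) (ComplexPoints Y) a y, ?_⟩
    rw [map_smul, hu y, smul_smul, inv_mul_cancel₀ hu0, one_smul]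

/-! ### The stub -/

/-- **STUB `stub_gysinRangeRational` (the image of a Gysin morphism is spanned by its rational
classes) of the crux `TranscendentalOrSupported`, line `Sketch`.** For a morphism `g : Y ⟶ X` of
smooth projective varieties of dimensions `m`, `n`, every orientation family `μ` and degrees
`a + 2n = b + 2m`, the image of `g_* = complexGysin μ hY hX g hab : Hᵃ(Y(ℂ); ℂ) → Hᵇ(X(ℂ); ℂ)` is
the complex span of its rational classes. Proof: `≤` is `Submodule.span_le`; for `≥`,
`Hᵃ(Y(ℂ); ℂ)` is spanned by rational classes (`span_isRationalClass_eq_top_of_isSmoothProjective_holds`,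
Voisin I §7.1.1), and the Gysin image of a rational class lies in the span
(`gysinRangeRational_apply_mem_span`: on rational classes `g_*` is the rational Gysin homomorphism
up to ONE non-zero scalar, `complexGysin_ringChange_eq_smul_gysinMap`), so `im g_*`, the image of
the span of the rational classes, lies in the span (`Submodule.span_induction`).
[cite: VoisinHodgeI2002, §7.1.1 and §7.3.2] [cite: FultonYoungTableaux1997, Appendix B §B.1 (5)]
[cite: GrothendieckTopology1969, p. 300] -/
theorem stub_gysinRangeRational :
    ∀ (μ : OrientationFamily) ⦃m n : ℕ⦄ ⦃Y X : SchemeOver ℂ⦄ (hY : IsSmoothProjective m Y)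
    (hX : IsSmoothProjective n X) (g : Y ⟶ X) ⦃a b : ℕ⦄ (hab : a + 2 * n = b + 2 * m),
    Submodule.span ℂ {x : complexBetti X b |
        x ∈ LinearMap.range (complexGysin μ hY hX g hab) ∧ IsRationalClass x} =
      LinearMap.range (complexGysin μ hY hX g hab) := by
  intro μ m n Y X hY hX g a b hab
  refine le_antisymm (Submodule.span_le.2 fun x hx ↦ hx.1) ?_
  rintro _ ⟨c, rfl⟩
  -- `c` is a complex combination of rational classes
  have hc : c ∈ Submodule.span ℂ {c : complexBetti Y a | IsRationalClass c} := by
    rw [span_isRationalClass_eq_top_of_isSmoothProjective_holds m Y hY a]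
    exact Submodule.mem_top
  induction hc using Submodule.span_induction with
  | mem c hc => exact gysinRangeRational_apply_mem_span μ hY hX g hab hc
  | zero =>
    rw [map_zero]
    exact Submodule.zero_mem _
  | add c c' _ _ hc hc' =>
    rw [map_add]
    exact Submodule.add_mem _ hc hc'
  | smul t c _ hc =>
    rw [map_smul]
    exact Submodule.smul_mem _ _ hc

end Summit.HodgeConjecture.HodgeConjecture.Theorems

end
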